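import Mathlib
import Summits.QuantumFields.BalabanUV.Beta.FP.PeriodicTransport

/-!
# Road «FP» (binder row D1), REP∞ — ALG-2, the PERIODIC transport identity: residue decomposition and assembly

Continuation of `FP/PeriodicTransport.lean` (`HOME/b2b-balaban-beta-d1-p3/REP-DESIGN.md` v1.1).
* §3 the residue equivalence `ℤ^d ≃ (Fin d → Fin N) × ℤ^d`, `u = resSite r + N•t`, and the splitting of lattice series into
  residue classes (`tsum_eq_sum_residue`, `hasSum_residue_iff`);
* §4 coset sums as `t`-series (`hasSum_coset_iff_shift`).
(The Fubini steps and the final assembly `periodicTransport_hasSum` follow in §5–§7.)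
[folklore] throughout; `d` arbitrary; nothing about Bałaban's objects is asserted.
HONEST FRAMING: bookkeeping toward `hident` (GAPS O-asym1-7); discharges nothing of `BetaPertH`; NOT the continuum limit, NOT Clay.
-/

noncomputable section

open Filter Topology
open scoped BigOperators

namespace Summit.QuantumFields.BalabanUV.Beta.FP.PeriodicTransportSum

open Literature.MathematicalPhysics.QuantumFieldTheory.Balaban1983to89
open Literature.MathematicalPhysics.QuantumFieldTheory.Balaban1983to89.Beta
open Literature.MathematicalPhysics.QuantumFieldTheory.Balaban1983to89.Beta.DecimatedMoment (cosetInd)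
open Literature.MathematicalPhysics.QuantumFieldTheory.Balaban1983to89.Beta.DecimatedMomentLimit (abs_cosetInd_le_one cosetInd_zsmul)
open Literature.MathematicalPhysics.QuantumFieldTheory.Balaban1983to89.Beta.DecimatedMomentSummable
  (ConstReproSum LinReproSum AbsMoment₂ IsMoment₂)
open Literature.MathematicalPhysics.QuantumFieldTheory.Balaban1983to89.Beta.DressedMomentNormalisation
  (resSite resOf resSite_resOf cosetInd_resSite_sub)
open Summit.QuantumFields.BalabanUV.Beta.FP.PeriodicTransport

variable {d N : ℕ}

/-! ## §3 The residue decomposition `u = resSite r + N • t` -/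

/-- [our object] The quotient part of a lattice point: `t_i := u_i / N` (Euclidean division). -/
def quotOf (N : ℕ) (u : Fin d → ℤ) : Fin d → ℤ := fun i => u i / (N : ℤ)

/-- [folklore] Euclidean division coordinatewise: `u = resSite (resOf u) + N • quotOf u`. -/
theorem resSite_add_zsmul_quotOf (hN : 0 < N) (u : Fin d → ℤ) :
    resSite (resOf hN u) + (N : ℤ) • quotOf N u = u := by
  funext i
  simp only [Pi.add_apply, Pi.smul_apply, smul_eq_mul, resSite_resOf hN u i, quotOf]
  exact Int.emod_add_mul_ediv (u i) (N : ℤ)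

/-- [folklore] The residue of `resSite r + N • t` is `r`. -/
theorem resOf_resSite_add_zsmul (hN : 0 < N) (r : Fin d → Fin N) (t : Fin d → ℤ) :
    resOf hN (resSite r + (N : ℤ) • t) = r := by
  funext i
  apply Fin.ext
  have h0 : (0 : ℤ) ≤ ((r i : ℕ) : ℤ) := by positivity
  have h1 : ((r i : ℕ) : ℤ) < (N : ℤ) := by exact_mod_cast (r i).isLt
  have key : ((resOf hN (resSite r + (N : ℤ) • t) i : ℕ) : ℤ) = ((r i : ℕ) : ℤ) := by
    have h := resSite_resOf hN (resSite r + (N : ℤ) • t) i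
    simp only [resSite, Pi.add_apply, Pi.smul_apply, smul_eq_mul] at h
    rw [h, Int.add_mul_emod_self_left, Int.emod_eq_of_lt h0 h1]
  exact_mod_cast key

/-- [folklore] The quotient of `resSite r + N • t` is `t`. -/
theorem quotOf_resSite_add_zsmul (hN : 0 < N) (r : Fin d → Fin N) (t : Fin d → ℤ) :
    quotOf N (resSite r + (N : ℤ) • t) = t := by
  funext i
  have hN' : (N : ℤ) ≠ 0 := by exact_mod_cast hN.ne'
  have h0 : (0 : ℤ) ≤ ((r i : ℕ) : ℤ) := by positivity
  have h1 : ((r i : ℕ) : ℤ) < (N : ℤ) := by exact_mod_cast (r i).isLt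
  simp only [quotOf, Pi.add_apply, Pi.smul_apply, smul_eq_mul, resSite]
  rw [Int.add_mul_ediv_left _ _ hN', Int.ediv_eq_zero_of_lt h0 h1, zero_add]

/-- [our object] **The residue equivalence** `ℤ^d ≃ (Fin d → Fin N) × ℤ^d`, `u ↦ (resOf u, quotOf u)`, inverse `(r,t) ↦ resSite r + N•t`. -/
def resEquiv (hN : 0 < N) : (Fin d → ℤ) ≃ (Fin d → Fin N) × (Fin d → ℤ) where
  toFun u := (resOf hN u, quotOf N u)
  invFun p := resSite p.1 + (N : ℤ) • p.2
  left_inv u := resSite_add_zsmul_quotOf hN u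
  right_inv p := by
    ext1
    · exact resOf_resSite_add_zsmul hN p.1 p.2
    · exact quotOf_resSite_add_zsmul hN p.1 p.2

/-- [folklore] **Splitting a lattice series into residue classes**: for a summable `f`,
`Σ'_u f u = Σ_r Σ'_t f (resSite r + N•t)`. -/
theorem tsum_eq_sum_residue (hN : 0 < N) {f : (Fin d → ℤ) → ℝ} (hf : Summable f) :
    ∑' u, f u = ∑ r : Fin d → Fin N, ∑' t : Fin d → ℤ, f (resSite r + (N : ℤ) • t) := by
  have e1 : ∑' u, f u = ∑' p : (Fin d → Fin N) × (Fin d → ℤ), f ((resEquiv hN).symm p) :=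
    ((resEquiv hN).symm.tsum_eq f).symm
  rw [e1]
  have hs : Summable fun p : (Fin d → Fin N) × (Fin d → ℤ) => f ((resEquiv hN).symm p) :=
    (resEquiv hN).symm.summable_iff.2 hf
  rw [hs.tsum_prod, tsum_fintype]
  rfl

/-- [folklore] The `t`-series of one residue class is summable when `f` is. -/
theorem summable_residue_class (hN : 0 < N) {f : (Fin d → ℤ) → ℝ} (hf : Summable f) (r : Fin d → Fin N) :
    Summable fun t : Fin d → ℤ => f (resSite r + (N : ℤ) • t) := by
  have hs : Summable fun p : (Fin d → Fin N) × (Fin d → ℤ) => f ((resEquiv hN).symm p) :=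
    (resEquiv hN).symm.summable_iff.2 hf
  exact hs.prod_factor r

/-! ## §4 Coset sums (windowed by `cosetInd N (a − ·)`) as `t`-series over the class of `a` -/

/-- [folklore] `cosetInd N (a − u) = 1` iff `u` lies in the residue class of `a`, i.e. `u = resSite (resOf a) + N•t`:
the windowed series `Σ'_u cosetInd N (a − u) • g u` is the `t`-series `Σ'_t g (a + N•t)` (unconditionally: reindexing along an injection off whose range the terms vanish). -/
theorem tsum_coset_eq_tsum_shift (hN : 0 < N) (a : Fin d → ℤ) (g : (Fin d → ℤ) → ℝ) :
    ∑' u, (cosetInd N (a - u) : ℝ) * g u = ∑' t : Fin d → ℤ, g (a + (N : ℤ) • t) := by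
  -- reindex `u = a − N•(−t)`… use the dilation embedding `t ↦ a + N•t` (injective), off whose range the window vanishes
  have hN' : (N : ℤ) ≠ 0 := by exact_mod_cast hN.ne'
  have hinj : Function.Injective fun t : Fin d → ℤ => a + (N : ℤ) • t := by
    intro t t' h
    have : (N : ℤ) • t = (N : ℤ) • t' := add_left_cancel h
    funext i
    have hi := congrFun this i
    simp only [Pi.smul_apply, smul_eq_mul] at hi
    exact mul_left_cancel₀ hN' hi
  have hzero : ∀ u, u ∉ Set.range (fun t : Fin d → ℤ => a + (N : ℤ) • t) → (cosetInd N (a - u) : ℝ) * g u = 0 := by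
    intro u hu
    have : cosetInd N (a - u) = 0 := by
      unfold cosetInd
      rw [if_neg]
      intro hdvd
      apply hu
      refine ⟨fun i => -((a - u) i / (N : ℤ)), funext fun i => ?_⟩
      simp only [Pi.add_apply, Pi.smul_apply, smul_eq_mul]
      have hi := Int.ediv_mul_cancel (hdvd i)
      simp only [Pi.sub_apply] at hi ⊢
      linarith [hi, mul_comm ((a i - u i) / (N : ℤ)) (N : ℤ)]
    rw [this, Int.cast_zero, zero_mul]
  rw [← hinj.tsum_eq (f := fun u => (cosetInd N (a - u) : ℝ) * g u)
    (fun u hu => Classical.byContradiction fun hnu => hu (hzero u hnu))]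
  refine tsum_congr fun t => ?_
  have : cosetInd N (a - (a + (N : ℤ) • t)) = 1 := by
    rw [show a - (a + (N : ℤ) • t) = (N : ℤ) • (-t) by simp [smul_neg], cosetInd_zsmul]
  rw [this, Int.cast_one, one_mul]


end Summit.QuantumFields.BalabanUV.Beta.FP.PeriodicTransportSum

end
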